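import Summits.HodgeConjecture.HodgeConjecture.Theorems.PadicSemiregularLiftHodgeFermatVarietiesFiveQClassification
import Summits.HodgeConjecture.HodgeConjecture.Theorems.PadicSemiregularLiftHodgeFermatVarietiesDoublingHodge
import HarnessLib

/-!
# Hodge sextuples of level `5q`, VI: reachability from the printed supply and HC for the Fermat fourfolds `X⁴_{5q}` — stub S13 `stub_reachFiveQ` of line `cancel-by-any-claim-lattice`, crux `HodgeFermatVarieties` (stmt-HodgeConjecture-1334)

Crux `HodgeFermatVarieties` (stmt-HodgeConjecture-1334), line `cancel-by-any-claim-lattice`, stub S13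
`stub_reachFiveQ` (skeleton generation 12, lead c4; worker file of wave 1). Last file of lead c3's
level-`5q` programme (`…FiveQPrelim/Structure/Units/Symmetric/Fibre/Classification`). Everything here is
PROVED (no `sorry`, no new definition, no new named fact).

* `stub_reachFiveQ` (registered signature): for a prime `q ≥ 7`, every Hodge SEXTUPLE `s` of `ℤ/5q` is
  ℤ-reachable from the printed supply of level `5q` AT ITS OWN LEVEL — indeed with `N = 0`. By the landed
  classification `FiveQ.classification` the sextuple is either three pairs `{a, -a}`, `a ≠ 0` (first
  component of the supply; `P :=` the pairs, `ΣP = Q + (-Q)` is `ReachOfLargePrimes.sum_map_pair`), or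
  Aoki's `5`-standard multiset `σ_{5,a} = {a + i q : i < 5} + {-5a}` of a UNIT `a` — verbatim the fourth
  component of the supply with `p = 5`, `d = 5q/5 = q`, Aoki's side condition `2 < d/(⟨a⟩, d)` holding
  because `(⟨a⟩, q) = 1` and `q ≥ 7` (`two_lt_div_gcd_of_isUnit`).
* `hodgeConjectureFor_fourfold_five_mul_prime` — **HC FOR EVERY SMOOTH PROJECTIVE COMPLEX FERMAT FOURFOLD
  OF DEGREE `5q`, `q ≥ 7` PRIME** (`35, 55, 65, 85, 95, 115, …`), granted exactly the hypotheses of every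
  earlier pay-off of the line (the named facts Aoki 1987 Thm 1-4 (i),(ii), Thm 1-1, Thm 2-1 and
  Aoki–Shioda 1983 (2.1); the statements of the stubs S2↑/S2↓, S3a and S5, spelled as in
  `…DoublingHodge`): every Hodge character of `X⁴_{5q}` has six entries, so its value multiset is
  reachable (`stub_reachFiveQ`), hence claimed (`Doubling.claimMultiset_of_stableReach`: the lattice
  criterion S1 over the printed supply S3b), and the per-dimension transfer
  `hodgeConjectureFor_of_claims_dim` (middle degree from the eigenspace structure at `(5q, 2)`, the
  other degrees by hypersurface Lefschetz, discharged) applies. This is da Silva 2021 Thm 3.3 at the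
  degrees `5q` with the classification `𝔅⁴_{5q} = 𝔇⁴_{5q} ∪ {σ_{5,a}}` that its printed proof silently
  needs now supplied (`…FiveQClassification`), the `σ_{5,a}`-eigenlines being algebraic by Aoki 1987
  Thm 2-1 (the explicit subvariety), not by Shioda's induction.

The engine S4 is not used: in dimension `4` the level `5q` carries no residual sign class. An all-`n`
wrapper is deliberately NOT here (other dimensions need Hodge multisets of other lengths).

References: [Aoki1983] N. Aoki, Math. Ann. 266 (1983) Thm A′ (§7); [Aoki1987] N. Aoki, J. Math. Soc.
Japan 39 (1987) §1 p. 387, Thm 1-4, Thm 2-1; [daSilva2021HodgeFermat] arXiv:2101.04739 Thm 3.3;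
[Shioda1979PJA] T. Shioda, Proc. Japan Acad. 55A (1979) §2 Thm 1; [Ran1980] Z. Ran, Compositio Math. 42
(1980) Prop. 1.7.
-/

set_option linter.dupNamespace false

noncomputable section

open Finset
open CategoryTheory AlgebraicGeometry
open Literature.AlgebraicGeometry Literature.AlgebraicGeometry.Motives Literature.AlgebraicTopology.SingularHomology
open Literature.AlgebraicGeometry.HodgeTheory Literature.AlgebraicGeometry.HodgeTheory.FermatCharacter

namespace Summit.HodgeConjecture.HodgeConjecture.Theorems.CancelByAnyClaimLattice.FiveQ

/-- `Supply[M]` — the printed supply of level `M` (local notation of the line, verbatim). -/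
local notation3 (prettyPrint := false) "Supply[" M "]" =>
  ({s : Multiset (ZMod M) | ∃ a : ZMod M, a ≠ 0 ∧ s = ({a, -a} : Multiset (ZMod M))} ∪
    {s : Multiset (ZMod M) | IsHodgeMultiset s ∧ Multiset.card s = 4} ∪
    {s : Multiset (ZMod M) | IsHodgeMultiset s ∧ IsSemiDecomposable s} ∪
    {s : Multiset (ZMod M) | ∃ (p : ℕ) (a : ZMod M), p.Prime ∧ p ≠ 2 ∧ p ∣ M ∧
        2 < (M / p) / Nat.gcd (ZMod.val a) (M / p) ∧
        s = Multiset.map (fun j : ℕ => a + (j : ZMod M) * ((M / p : ℕ) : ZMod M)) (Multiset.range p) +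
              {-((p : ZMod M) * a)}} : Set (Multiset (ZMod M)))

/-- `Reach[M, s]` (local notation of the line, verbatim). -/
local notation3 (prettyPrint := false) "Reach[" M ", " s "]" =>
  ∃ P N : Multiset (Multiset (ZMod M)),
    (∀ u ∈ P, u ∈ Supply[M]) ∧ (∀ u ∈ N, u ∈ Supply[M]) ∧ s + Multiset.sum N = Multiset.sum P

/-- `LevelRaise[k, m, s]` (local notation of the line, verbatim). -/
local notation3 (prettyPrint := false) "LevelRaise[" k ", " m ", " s "]" =>
  Multiset.map (fun a : ZMod m => ((k * ZMod.val a : ℕ) : ZMod (k * m))) s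

/-- `StableReach[m, s]` (local notation of the line, verbatim). -/
local notation3 (prettyPrint := false) "StableReach[" m ", " s "]" => ∃ k : ℕ, 0 < k ∧ Reach[k * m, LevelRaise[k, m, s]]

/-- The statement of stub S2↑ (pull-back of claim along level raising). Local notation only, verbatim
`…DoublingHodge`. -/
local notation3 (prettyPrint := false) "LevelClaimPull" =>
  ∀ (m k r : ℕ) (α' : Fin (2 * r + 2) → ZMod m), 0 < k → (∀ i, α' i ≠ 0) →
    FermatCharacter.Claim m r α' → FermatCharacter.Claim (k * m) r (fun i => ((k * (α' i).val : ℕ) : ZMod (k * m)))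

/-- The statement of stub S2↓ (push-forward of claim along level raising). Local notation only, verbatim
`…DoublingHodge`. -/
local notation3 (prettyPrint := false) "LevelClaimPush" =>
  ∀ (m k r : ℕ) (α' : Fin (2 * r + 2) → ZMod m), 0 < k → (∀ i, α' i ≠ 0) →
    FermatCharacter.Claim (k * m) r (fun i => ((k * (α' i).val : ℕ) : ZMod (k * m))) → FermatCharacter.Claim m r α'

/-- The statement of stub S3a (Shioda's semi-decomposable supply is claimed). Local notation only, verbatim
`…DoublingHodge`. -/
local notation3 (prettyPrint := false) "SemiClaim" =>
  ∀ (M : ℕ) [NeZero M] (s : Multiset (ZMod M)), IsHodgeMultiset s → IsSemiDecomposable s → ClaimMultiset M s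

/-- The statement of stub S5 (eigenspace structure of `H²ᵖ(X²ᵖₘ)`, Ran Prop. 1.7) at every level. Local
notation only, verbatim `…DoublingHodge`. -/
local notation3 (prettyPrint := false) "EigenStructure" =>
  ∀ (m : ℕ) [NeZero m] ⦃p : ℕ⦄, 0 < p →
    (∀ α : Fin (2 * p + 2) → ZMod m, α ≠ 0 → (∃ i, α i = 0) → fermatEigenspace m α (2 * p) = ⊥) ∧
    (fermatEigenspace m (0 : Fin (2 * p + 2) → ZMod m) (2 * p) ≤
      LinearMap.range (complexBetti.map (SmoothHypersurface.hypersurfaceι (fermatPolynomial ℂ (2 * p) m)) (2 * p)).hom) ∧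
    (∀ (A : HodgeModel (2 * p) (fermatHypersurface (2 * p) m)) (β : Fin (2 * p + 2) → ZMod m),
      (∀ i, β i ≠ 0) →
      (∃ x ∈ fermatEigenspace m β (2 * p), x ≠ 0 ∧ A.pullback (2 * p) x ∈ A.hodgePQ (2 * p) p p) →
        2 * FermatCharacter.normSum β = m * (2 * p + 2))

/-! ### §1 Aoki's `5`-standard multiset of a unit lies in the printed supply of level `5q` -/

section Level5q

variable {q : ℕ}

/-- **Aoki's side condition for `σ_{5,a}` at level `5q` with `a` a unit**: `d/(⟨a⟩, d) = q > 2` where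
`d = 5q/5 = q`, because `⟨a⟩` is prime to `5q`, hence to `q`. [cite: Aoki1987, §1 p. 387] -/
theorem two_lt_div_gcd_of_isUnit (hq : 7 ≤ q) {a : ZMod (5 * q)} (ha : IsUnit a) :
    2 < (5 * q / 5) / Nat.gcd a.val (5 * q / 5) := by
  obtain ⟨u, rfl⟩ := ha
  have hcop : Nat.Coprime (u : ZMod (5 * q)).val q :=
    (ZMod.val_coe_unit_coprime u).coprime_dvd_right (dvd_mul_left q 5)
  rw [Nat.mul_div_cancel_left q (by norm_num : 0 < 5), Nat.Coprime.gcd_eq_one hcop, Nat.div_one]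
  omega

/-- **`σ_{5,a} = {a + i q : i < 5} + {-5a}` of a unit `a` lies in the printed supply of level `5q`**
(`q ≥ 7` prime): it is VERBATIM the fourth component with the witnesses `p = 5`, `a` (`5` is an odd
prime dividing `5q`, and the side condition is `two_lt_div_gcd_of_isUnit`; the two spellings
`(5 : ℤ/5q)` and `((5 : ℕ) : ℤ/5q)` of the last entry agree definitionally). [cite: Aoki1987, Thm. 2-1 (p. 388)] -/
theorem fiveStandard_mem_supply (hq : 7 ≤ q) {a : ZMod (5 * q)} (ha : IsUnit a) :
    (Multiset.range 5).map (fun i : ℕ ↦ a + (i : ZMod (5 * q)) * ((5 * q / 5 : ℕ) : ZMod (5 * q))) +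
        {-((5 : ZMod (5 * q)) * a)} ∈ Supply[5 * q] :=
  Or.inr ⟨5, a, Nat.prime_five, by norm_num, dvd_mul_right 5 q, two_lt_div_gcd_of_isUnit hq ha, rfl⟩

end Level5q

/-! ### §2 S13: every Hodge sextuple of level `5q` is reachable at its own level -/

/-- **S13 `stub_reachFiveQ` — every Hodge sextuple of level `5q` (`q ≥ 7` prime) is ℤ-reachable from the
printed supply AT ITS OWN LEVEL** (registered signature of line `cancel-by-any-claim-lattice`). By the
classification `FiveQ.classification` (Aoki 1983 Thm A′ refined at the prime `5`): either `s = Q + (-Q)`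
with `Q` zero-free — take `P :=` the pairs `{a, -a}`, `a ∈ Q` (first component of the supply), `N := 0`,
`ΣP = Q + (-Q)` — or `s = σ_{5,a}` with `a` a unit — take `P := {s}` (`fiveStandard_mem_supply`), `N := 0`.
[cite: Aoki1983, Thm. A′ (§7)] [cite: Aoki1987, Thm. 2-1 (p. 388)] -/
theorem stub_reachFiveQ :
    ∀ (q : ℕ) [Fact q.Prime], 7 ≤ q → ∀ s : Multiset (ZMod (5 * q)), IsHodgeMultiset s → Multiset.card s = 6 →
      Reach[5 * q, s] := by
  intro q _ hq s hs h6
  rcases classification hq hs h6 with ⟨Q, hQ, hsQ⟩ | ⟨a, ha, hsa⟩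
  · -- three pairs: `P :=` the pairs of `Q`, `N := 0`
    refine ⟨Q.map fun a ↦ ({a, -a} : Multiset (ZMod (5 * q))), 0, fun u hu ↦ ?_,
      fun u hu ↦ absurd hu (Multiset.notMem_zero u), ?_⟩
    · obtain ⟨a, haQ, rfl⟩ := Multiset.mem_map.1 hu
      exact ReachPrimePow.pair_mem_supply (hQ a haQ)
    · rw [Multiset.sum_zero, add_zero, ReachOfLargePrimes.sum_map_pair]
      exact hsQ
  · -- Aoki's `5`-standard multiset of a unit: `P := {s}`, `N := 0`
    refine ⟨{s}, 0, fun u hu ↦ ?_, fun u hu ↦ absurd hu (Multiset.notMem_zero u), ?_⟩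
    · rw [Multiset.mem_singleton] at hu
      rw [hu, hsa]
      exact fiveStandard_mem_supply hq ha
    · rw [Multiset.sum_zero, add_zero, Multiset.sum_singleton]

/-! ### §3 Pay-off: HC for the Fermat fourfolds of degree `5q` -/

/-- **HC FOR EVERY SMOOTH PROJECTIVE COMPLEX FERMAT FOURFOLD OF DEGREE `5q`, `q ≥ 7` PRIME** (`35, 55, 65,
85, 95, 115, …`), granted the named facts Aoki 1987 Thm 1-4 (i) `hJ`, (ii) `hC`, Thm 1-1 `hP`, Thm 2-1 `hS`,
Aoki–Shioda 1983 (2.1) `hNS`, and the statements of the stubs S2↑ `hPull`, S2↓ `hPush`, S3a `h3a`, S5 `h5`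
(exactly the hypotheses of `Doubling.hodgeConjectureFor_two_mul_of_largePrimes_dim`): every Hodge character
`α` of `X⁴_{5q}` has six entries, so its value multiset is reachable at level `5q` (`stub_reachFiveQ`),
hence claimed (`Doubling.claimMultiset_of_stableReach`), and the per-dimension transfer
`hodgeConjectureFor_of_claims_dim` at `(5q, 2)` applies. Da Silva 2021 Thm 3.3 at the degrees `5q`, with
the missing classification supplied. [cite: daSilva2021HodgeFermat, Thm. 3.3] [cite: Aoki1983, Thm. A′ (§7)]
[cite: Aoki1987, Thm. 2-1 (p. 388)] -/
theorem hodgeConjectureFor_fourfold_five_mul_prime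
    (hJ : Aoki1987_claim_juxtaposition) (hC : Aoki1987_claim_of_claim_juxtaposition_paired)
    (hP : Shioda_claim_paired) (hNS : AokiShioda1983_eigenline_le_neronSeveri) (hS : Aoki1987_claim_pStandard)
    (hPull : LevelClaimPull) (hPush : LevelClaimPush) (h3a : SemiClaim) (h5 : EigenStructure)
    {q : ℕ} [Fact q.Prime] (hq : 7 ≤ q)
    ⦃X : SchemeOver ℂ⦄ (hF : IsFermatVariety 4 (5 * q) X) (hX : IsSmoothProjective 4 X) :
    HodgeConjectureFor 4 X := by
  haveI : NeZero (5 * q) := ⟨Nat.mul_ne_zero (by norm_num) (Fact.out : q.Prime).ne_zero⟩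
  refine hodgeConjectureFor_of_claims_dim (m := 5 * q) (p := 2) two_pos (h5 (5 * q) two_pos).1
    (h5 (5 * q) two_pos).2.1 (h5 (5 * q) two_pos).2.2 (fun α hα ↦ ?_) hF hX
  have hs : IsHodgeMultiset (univ.val.map α) := hα.isHodgeMultiset
  have hcard : Multiset.card (univ.val.map α) = 6 := by rw [card_univ_val_map]
  have hs0 : univ.val.map α ≠ 0 := fun h0 ↦ by
    have h := congrArg Multiset.card h0
    rw [hcard, Multiset.card_zero] at h
    exact absurd h (by norm_num)
  have hR : Reach[5 * q, univ.val.map α] := stub_reachFiveQ q hq _ hs hcard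
  exact (claimMultiset_univ_val_map_iff α).1
    (Doubling.claimMultiset_of_stableReach hJ hC hP hNS hS hPull hPush h3a hs0 hs
      (Doubling.stableReach_of_reach hR))

end Summit.HodgeConjecture.HodgeConjecture.Theorems.CancelByAnyClaimLattice.FiveQ

end
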